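import Literature.MathematicalPhysics.QuantumFieldTheory.Balaban1983to89.B9GradLetterTransportedInputClassesPI
import Literature.MathematicalPhysics.QuantumFieldTheory.Balaban1983to89.B9BlockNormClassTransfer

/-!
# `Balaban1983to89.B9GradLetterTransportedSupSource` — [B9] (3.44) p. 398 + (3.40) p. 397: A SUP WORD OUT OF THE BLOCK-SUP CLASS ENTERS THE PRINT-EXACT TRANSPORTED SITE
# FAMILY `bHZPIfam (taxiS U) ε` (EVERY ε) — the certificate's `htransW` slot of the U-dependent W-sector state producer (dag-n06-d's `…StateProducersBAtPinsPUW`)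

T. Bałaban, *Propagators for lattice gauge theories in a background field*, Commun. Math. Phys. **99** (1985) 389–434 [`Balaban1985BackgroundPropagators`]; [4] = T. Bałaban,
*Propagators and renormalization transformations for lattice gauge theories. II*, Commun. Math. Phys. **96** (1984) 223–250 [`Balaban1984PropagatorsII`].
statement-level skeleton of published theorems with citation tags; proofs where landed; nothing here is a claim about the Yang–Mills mass gap.

THE PRINT.  (3.44) p. 398: *"|(∇_UG(U)∇\*_Uλ)(x)| ≦ B′₀(ε)e^{−δ₀d(y,y′)}(‖λ‖^{ξ′}_ε + |λ|)"* — the SUP channel `|λ|` of the input functional: a word bounded out of the plain block-sup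
class (`‖λ‖_∞` per block, here `BlockNorm.ofBlocks … (blkSK sI)`) is bounded out of the Hölder input class `|λ| + ‖λ‖^{ξ′}_ε` localised on the neighbourhood `Δ̃(y′)` (p. 397),
at the cost of the neighbourhood's block multiplicity and `e^{ρ·r_near}` ([4] (2.61) p. 234 counts the blocks within `r`).

WHY THIS FILE (cell `pub-ymgap`, node N06 [B9], seat `pub-ymgap-dag-n06-c` g21; dag-n06-d g21's ask I.≈31894∕31924 `hasMaj_bHZPIfam_of_supBlocks`).  §1 `card_filter_dist_le_of_rowSum` (the number of
carrier indices within `r` of `y′` is `≤ e^{σr}·c` under `RowSum σ c`, row orientation; the class transfer with kernel slack is dag-n06-d's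
`B9BlockNormClassTransfer.hasMaj_of_dom_classes_le`, imported); §2 ★★ `hasMaj_bHZPI_of_supBlocks` ∕ ★★ `hasMaj_bHZPIfam_of_supBlocks`: from
`HasMaj (ofBlocks (blkSK (sIK bI))) b₂ T (K·e^{−ρd})` to `HasMaj (bHZPIfam g ε) b₂ T ((e^{σ(r_near+1)}·c)·e^{ρ(r_near+1)}·K·e^{−ρd})`, any target class `b₂`, any `g`, every `ε`
(localisation in `bHZPIfam` = vanishing off `Δ̃(y′)`, whose points lie in blocks within `r_near + 1` of `y′`: `dist_sIK_le_of_nearY`; each block piece is below the sup channel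
`|λ| ≤ loc`: `B9GradLetterTransportedInputClassesPI` §4's pattern).

HONEST SCOPE.  Block-norm bookkeeping over landed modules; no estimate of [B9] asserted; COUNT-NEUTRAL; N06 NOT discharged; nothing continuum, nothing about the mass gap.
A NEW file; 0 `def`, no `sorry`, no `axiom`, no `instance`, no `notation`.
-/

noncomputable section

namespace Literature.MathematicalPhysics.QuantumFieldTheory.Balaban1983to89.B9GradLetterTransportedSupSource

open B6GlobalChartV1 (blkV1)
open B6Geom246MultiLevelTorus (geomT)
open B6Ineq2142KLevelV1 (β)
open B6KLevelCensusIndexV1 (KIdx)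
open B6Prop22KLevelTorusCensusEta (nKT)
open B9GeoNormsKLevelV1 (geo9K geo9K_dist_nonneg)
open B9GeoLemma21KLevelV1 (geo9K_len_pos geo9K_dist_comm geo9K_dist_triangle)
open B9Thm34Ext (toB6)
open B6RandomWalk (blockPiece)
open B11SectG (BlockNorm HasMaj RowSum)
open B11SectGGlobal (Size)
open B11SectGGlobalSizes
open B9CoReadingCoordsS (XSK sIK blkSK)
open B9MultiscaleSmoothPartitionY (NearY)
open B9MultiscaleSmoothPartitionYNear (rNear rNear_nonneg dist_sIK_le_of_nearY)
open B9SmoothHolderClassPI (bHZPI bHZPIfam bHZPIfam_of_mem)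
open B9GradLetterTransportedInputClassesPI (bHZPIfam_of_not_mem)
open B9BlockNormClassTransfer (hasMaj_of_dom_classes_le)
open Node00 (SiteY FBondY IBondY toKT)

/-! ## §1 The neighbourhood count in the row orientation (the class transfer with kernel slack is `B9BlockNormClassTransfer.hasMaj_of_dom_classes_le`, dag-n06-d's v1.1) -/

section Generic

variable {g : B6.Geometry} {F₁ F₂ : Type} [AddCommGroup F₁] [Module ℝ F₁] [AddCommGroup F₂] [Module ℝ F₂]

/-- the number of carrier indices `a` with `d(y′, a) ≤ r` is `≤ e^{σr}·c` under `B11SectG.RowSum σ c` (`σ ≥ 0`; the ROW orientation of `RowSum`, no symmetry needed — the `nbr`-form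
with symmetry is `B9GeoNbrCountKLevelV1.card_nbr_le_of_rowSum`). [cite: Balaban1984PropagatorsII, Lemma 2.1 (2.61) p.234, (2.46) p.231] -/
theorem card_filter_dist_le_of_rowSum {σ c r : ℝ} (hrow : RowSum g σ c) (hσ : 0 ≤ σ) (y' : g.Site) :
    (((Finset.univ.filter fun a : g.Site => g.dist y' a ≤ r).card : ℕ) : ℝ) ≤ Real.exp (σ * r) * c := by
  classical
  have hsum : (∑ a : g.Site, Real.exp (-(σ * g.dist y' a))) ≤ c := hrow y'
  have h1 : ∀ a : g.Site, (if g.dist y' a ≤ r then (1 : ℝ) else 0) ≤ Real.exp (σ * r) * Real.exp (-(σ * g.dist y' a)) := by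
    intro a
    by_cases h : g.dist y' a ≤ r
    · rw [if_pos h, ← Real.exp_add]
      exact Real.one_le_exp (by nlinarith)
    · rw [if_neg h]; positivity
  calc (((Finset.univ.filter fun a : g.Site => g.dist y' a ≤ r).card : ℕ) : ℝ)
      = ∑ a : g.Site, (if g.dist y' a ≤ r then (1 : ℝ) else 0) := by rw [Finset.card_filter]; push_cast; rfl
    _ ≤ ∑ a : g.Site, Real.exp (σ * r) * Real.exp (-(σ * g.dist y' a)) := Finset.sum_le_sum fun a _ => h1 a
    _ = Real.exp (σ * r) * ∑ a : g.Site, Real.exp (-(σ * g.dist y' a)) := by rw [Finset.mul_sum]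
    _ ≤ Real.exp (σ * r) * c := mul_le_mul_of_nonneg_left hsum (Real.exp_nonneg _)

end Generic

/-! ## §2 The sup word enters the print-exact transported site class -/

section Site

variable {d ℓ : ℕ} {hd : 1 ≤ d + 1} {hL : Odd (ℓ + 1) ∧ 1 < ℓ + 1} {b₀ b₁ : ℝ}
variable {𝔸 : Type} [NormedRing 𝔸] [NormedAlgebra ℂ 𝔸]
variable {κ : Type} [Fintype κ]
variable (i : KIdx d ℓ hd hL b₀ b₁) [Fintype (geo9K i).Site] (b : Module.Basis κ ℝ 𝔸) {R : ℝ} {H : Prop} {bI : FBondY i → IBondY i}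

/-- a block piece of a vector localised in the print-exact class at `y′` vanishes unless the block is within `r_near + 1` of `y′`. [cite: Balaban1985BackgroundPropagators, (3.44) p.398 + p.397 (Δ̃(y)), bookkeeping] -/
theorem cut_ofBlocks_eq_zero_of_isLoc_bHZPI (hβ1 : ∀ f : FBondY i, (geomT i.D).dist (β i.hN i.D i.hk (bI f)) (blkV1 i.hN i.D f) ≤ 1)
    (g : SiteY i → SiteY i → 𝔸ˣ) {s : ℝ} (hs0 : 0 ≤ s) (hs1 : s ≤ 1) {y' y'' : IBondY i} {μ : XSK κ i → ℝ}
    (hμ : (bHZPI (κ := κ) i b g (R := R) (H := H) hs0 hs1).IsLoc y' μ) (hy : ¬ (geo9K i).dist y' y'' ≤ rNear d ℓ + 1) :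
    (BlockNorm.ofBlocks (toB6 (geo9K i) R H) (blkSK i (sIK i bI))).cut y'' μ = 0 := by
  rw [B9SmoothHolderClassPI.bHZPI_isLoc_iff] at hμ
  have hpt : ∀ p : XSK κ i, blockPiece (g := toB6 (geo9K i) R H) (blkSK i (sIK i bI)) y'' μ p = 0 := fun p => by
    unfold blockPiece
    split_ifs with h
    · have h' : sIK i bI p.1 = y'' := h
      by_cases hn : NearY i y' p.1
      · exact absurd (by rw [← h']; exact dist_sIK_le_of_nearY i hβ1 hn) hy
      · exact hμ p hn
    · rfl
  exact funext hpt

/-- a block piece of a vector localised in the print-exact class at `y′` is below the class size at `y′` (the unweighted sup channel `|λ|` of `|λ| + ‖λ‖^{ξ′}_s`).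
[cite: Balaban1985BackgroundPropagators, (3.44) p.398, bookkeeping] -/
theorem loc_ofBlocks_cut_le_loc_bHZPI (hcf : |i.cf| = (nKT (toKT i) : ℝ)) (g : SiteY i → SiteY i → 𝔸ˣ) {s : ℝ} (hs0 : 0 ≤ s) (hs1 : s ≤ 1)
    {y' : IBondY i} (y'' : IBondY i) {μ : XSK κ i → ℝ} (hμ : (bHZPI (κ := κ) i b g (R := R) (H := H) hs0 hs1).IsLoc y' μ) :
    (BlockNorm.ofBlocks (toB6 (geo9K i) R H) (blkSK i (sIK i bI))).loc y'' ((BlockNorm.ofBlocks (toB6 (geo9K i) R H) (blkSK i (sIK i bI))).cut y'' μ) ≤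
      (bHZPI (κ := κ) i b g (R := R) (H := H) hs0 hs1).loc y' μ := by
  classical
  rw [B9SmoothHolderClassPI.bHZPI_isLoc_iff] at hμ
  have hS0 : 0 ≤ (Size.ofSup (toB6 (geo9K i) R H) (fun (q : XSK κ i) (y : IBondY i) => NearY i y q.1)).sz y' μ := Size.nonneg _ _ _
  have hloc0 : 0 ≤ (bHZPI (κ := κ) i b g (R := R) (H := H) hs0 hs1).loc y' μ := (bHZPI (κ := κ) i b g (R := R) (H := H) hs0 hs1).loc_nonneg _ _
  -- every value of `μ` is below the class size
  have hq : ∀ p : XSK κ i, |μ p| ≤ (bHZPI (κ := κ) i b g (R := R) (H := H) hs0 hs1).loc y' μ := by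
    intro p
    rw [B9SmoothHolderClassPI.bHZPI_loc_print i b g hs0 hs1 hcf y' μ]
    have hsup : |μ p| ≤ (Size.ofSup (toB6 (geo9K i) R H) (fun (q : XSK κ i) (y : IBondY i) => NearY i y q.1)).sz y' μ := by
      by_cases h : NearY i y' p.1
      · exact ofSup_abs_le (g := toB6 (geo9K i) R H) (fun (q : XSK κ i) (y : IBondY i) => NearY i y q.1) h μ
      · rw [hμ p h, abs_zero]; exact hS0
    exact hsup.trans (le_add_of_nonneg_right (mul_nonneg (Real.rpow_nonneg (geo9K_len_pos i y').le _) (Size.nonneg _ _ _)))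
  -- the block sup of the piece
  change (⨆ p : XSK κ i, _) ≤ _
  refine Real.iSup_le (fun p => ?_) hloc0
  split_ifs with h
  · have hp : ((BlockNorm.ofBlocks (toB6 (geo9K i) R H) (blkSK i (sIK i bI))).cut y'' μ) p = μ p := by
      show blockPiece (g := toB6 (geo9K i) R H) (blkSK i (sIK i bI)) y'' μ p = μ p
      unfold blockPiece
      rw [if_pos h]
    rw [hp]
    exact hq p
  · exact hloc0

/-- ★★ **A SUP WORD OUT OF THE BLOCK-SUP CLASS ENTERS THE PRINT-EXACT CLASS `bHZPI g s`**: from `HasMaj (ofBlocks (blkSK (sIK bI))) b₂ T (K·e^{−ρd})` (`K, ρ ≥ 0`), a row sum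
`RowSum σ c` (`σ ≥ 0`) and `hβ1`, print's units: `HasMaj (bHZPI g s) b₂ T ((e^{σ(r_near+1)}·c)·(e^{ρ(r_near+1)}·K)·e^{−ρd})` — any target class, any `g`, any `0 ≤ s ≤ 1`.
[cite: Balaban1985BackgroundPropagators, (3.44) p.398 + (3.40) p.397; Balaban1984PropagatorsII, (2.51)–(2.52) p.232, Lemma 2.1 (2.61) p.234] -/
theorem hasMaj_bHZPI_of_supBlocks (hβ1 : ∀ f : FBondY i, (geomT i.D).dist (β i.hN i.D i.hk (bI f)) (blkV1 i.hN i.D f) ≤ 1) (hcf : |i.cf| = (nKT (toKT i) : ℝ))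
    (g : SiteY i → SiteY i → 𝔸ˣ) {s : ℝ} (hs0 : 0 ≤ s) (hs1 : s ≤ 1) {σ c : ℝ} (hrow : RowSum (toB6 (geo9K i) R H) σ c) (hσ : 0 ≤ σ)
    {F₂ : Type} [AddCommGroup F₂] [Module ℝ F₂] {b₂ : BlockNorm (toB6 (geo9K i) R H) F₂} {T : (XSK κ i → ℝ) →ₗ[ℝ] F₂} {K ρ : ℝ} (hK : 0 ≤ K) (hρ : 0 ≤ ρ)
    (h : HasMaj (BlockNorm.ofBlocks (toB6 (geo9K i) R H) (blkSK i (sIK i bI))) b₂ T (fun a a' => K * Real.exp (-(ρ * (geo9K i).dist a a')))) :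
    HasMaj (bHZPI (κ := κ) i b g (R := R) (H := H) hs0 hs1) b₂ T
      (fun a a' => (Real.exp (σ * (rNear d ℓ + 1)) * c) * ((Real.exp (ρ * (rNear d ℓ + 1)) * K) * Real.exp (-(ρ * (geo9K i).dist a a')))) := by
  classical
  have hr0 : 0 ≤ rNear d ℓ + 1 := by have := rNear_nonneg d ℓ; linarith
  refine hasMaj_of_dom_classes_le (g := toB6 (geo9K i) R H) (fun y'' y' : IBondY i => (geo9K i).dist y' y'' ≤ rNear d ℓ + 1)
    (fun y' μ hμ y'' hy => cut_ofBlocks_eq_zero_of_isLoc_bHZPI i b hβ1 g hs0 hs1 hμ hy)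
    (fun y' μ hμ y'' _ => loc_ofBlocks_cut_le_loc_bHZPI i b hcf g hs0 hs1 y'' hμ)
    (fun a a' => by positivity) (fun a y' y'' (hy : (geo9K i).dist y' y'' ≤ rNear d ℓ + 1) => ?_)
    (fun y' => card_filter_dist_le_of_rowSum (g := toB6 (geo9K i) R H) hrow hσ y') h
  -- the kernel across the neighbourhood: `K e^{−ρ d(a,y″)} ≤ e^{ρ(r+1)} K e^{−ρ d(a,y′)}` for `d(y′,y″) ≤ r + 1`
  have htri : (geo9K i).dist a y' ≤ (geo9K i).dist a y'' + (geo9K i).dist y'' y' := geo9K_dist_triangle i a y'' y'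
  rw [geo9K_dist_comm i y'' y'] at htri
  show K * Real.exp (-(ρ * (geo9K i).dist a y'')) ≤ (Real.exp (ρ * (rNear d ℓ + 1)) * K) * Real.exp (-(ρ * (geo9K i).dist a y'))
  rw [mul_comm (Real.exp _) K, mul_assoc, ← Real.exp_add]
  refine mul_le_mul_of_nonneg_left (Real.exp_le_exp.2 ?_) hK
  nlinarith [mul_le_mul_of_nonneg_left hy hρ, mul_le_mul_of_nonneg_left htri hρ]

/-- ★★ **THE SAME FOR THE TOTAL FAMILY `bHZPIfam g ε`, EVERY `ε`** (on `[0,1]` the class at `s = ε`, beyond it the `s = ½` class) — the certificate's `htransW` slot with the CLOSED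
`C_W = e^{σ(r_near+1)}·c·e^{ρ(r_near+1)}`. [cite: Balaban1985BackgroundPropagators, (3.44) p.398 + (3.40) p.397; Balaban1984PropagatorsII, (2.51)–(2.52) p.232, Lemma 2.1 (2.61) p.234] -/
theorem hasMaj_bHZPIfam_of_supBlocks (hβ1 : ∀ f : FBondY i, (geomT i.D).dist (β i.hN i.D i.hk (bI f)) (blkV1 i.hN i.D f) ≤ 1) (hcf : |i.cf| = (nKT (toKT i) : ℝ))
    (g : SiteY i → SiteY i → 𝔸ˣ) (ε : ℝ) {σ c : ℝ} (hrow : RowSum (toB6 (geo9K i) R H) σ c) (hσ : 0 ≤ σ)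
    {F₂ : Type} [AddCommGroup F₂] [Module ℝ F₂] {b₂ : BlockNorm (toB6 (geo9K i) R H) F₂} {T : (XSK κ i → ℝ) →ₗ[ℝ] F₂} {K ρ : ℝ} (hK : 0 ≤ K) (hρ : 0 ≤ ρ)
    (h : HasMaj (BlockNorm.ofBlocks (toB6 (geo9K i) R H) (blkSK i (sIK i bI))) b₂ T (fun a a' => K * Real.exp (-(ρ * (geo9K i).dist a a')))) :
    HasMaj (bHZPIfam (κ := κ) i b g (R := R) (H := H) ε) b₂ T
      (fun a a' => (Real.exp (σ * (rNear d ℓ + 1)) * c * Real.exp (ρ * (rNear d ℓ + 1))) * K * Real.exp (-(ρ * (geo9K i).dist a a'))) := by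
  by_cases h1 : 0 ≤ ε ∧ ε ≤ 1
  · rw [bHZPIfam_of_mem i b g h1.1 h1.2]
    exact (hasMaj_bHZPI_of_supBlocks i b hβ1 hcf g h1.1 h1.2 hrow hσ hK hρ h).mono fun a a' => le_of_eq (by ring)
  · rw [bHZPIfam_of_not_mem i b g h1]
    exact (hasMaj_bHZPI_of_supBlocks i b hβ1 hcf g (by norm_num) (by norm_num) hrow hσ hK hρ h).mono fun a a' => le_of_eq (by ring)

end Site

end Literature.MathematicalPhysics.QuantumFieldTheory.Balaban1983to89.B9GradLetterTransportedSupSource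

end
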